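import Literature.NumberTheory.GaloisRepresentations.LubinTateComparisonPoints
import Literature.NumberTheory.GaloisRepresentations.LubinTateUnramifiedFrobenius
import HarnessLib

/-!
# The coefficient map `j : 𝒪_E → 𝐃 = 𝒪̂_{F^nr}` of a finite unramified base `E ⊆ F^{nr}`, with its two
# compatibilities `j ∘ (𝒪_F → 𝒪_E) = (𝒪_F → 𝐃)` and `(𝐃 → 𝒪_{ℂ_F}) ∘ j = (𝒪_E ⊆ 𝒪_{ℂ_F})` (de Shalit I.3.8)

Topic `NumberTheory/GaloisRepresentations`; namespace `Literature.NumberTheory.GaloisRepresentations`.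

De Shalit, *Iwasawa theory of elliptic curves with complex multiplication* (1987), I.3.2–3.3 and I.3.8: the measure
of a norm-coherent unit over the unramified base `k' = E` is read from its series `(δ_{k'} g_β)~ ∈ 𝒪_{k'}⟦X⟧`
viewed in `𝐃⟦X⟧`, `𝐃 = 𝒪̂_{F^nr}` the completed maximal unramified integers, through `𝒪_{k'} ⊆ 𝒪_{F^nr} ⊆ 𝐃`.
The series-family instantiation `PAdicOneVariableSeriesFamilyOfRelNormCoherentUnits.lean` takes this coefficient map
as an abstract ring map `j : 𝒪_E →+* 𝐃` with the two hypotheses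

  `hj  : j ∘ (LTCoeff F → 𝒪_E) = intToUnrCoeff ∘ (LTCoeff F ≃ 𝒪_F)`  (`j` is the identity on `𝒪_F`),
  `hjC : (𝐃 → 𝒪_{ℂ_F}) ∘ j = unitBallToCBall E`                      (`j` followed by `ι : 𝐃 → ℂ_F` is `E ⊆ F̄ ⊆ ℂ_F`).

THIS file supplies the canonical `j` and proves both:

* `unitBallToMaxUnramifiedIntegers hE : unitBall E →+* maxUnramifiedIntegers F` (`x ↦ x`, for `E ≤ maxUnramified F`);
* `unitBallToUnrCoeff hE : unitBall E →+* UnrCoeff F` — **the coefficient map `j`** (followed by `𝒪_{F^nr} → 𝒪̂_{F^nr}`);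
* ★ `unitBallToUnrCoeff_comp_algebraMap` — `hj`; ★ `algebraMap_comp_unitBallToUnrCoeff` — `hjC`
  (`maxUnramifiedCompletion.toC` extends `𝒪_{F^nr} ⊆ F̄ → ℂ_F`: tree `toC_algebraMap'`).

Two small definitions with bodies; theorems otherwise; no named facts, no instances, no `sorry`.

## References

* [deShalit1987] E. de Shalit, *Iwasawa theory of elliptic curves with complex multiplication* (1987),
  I.3.2–3.3 (p. 16–17), I.3.8 (p. 20).
* [SerreLocalFields1979] J.-P. Serre, *Local Fields*, Ch. II §5.
-/

noncomputable section

namespace Literature.NumberTheory.GaloisRepresentations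

section UnramifiedBaseToCompletedIntegers

open ValuativeRel IsLocalRing Field IsNonarchimedeanLocalField LubinTate
open Literature.NumberTheory.PAdicHodge

variable {F : Type} [Field F] [ValuativeRel F] [TopologicalSpace F] [IsNonarchimedeanLocalField F]

attribute [local instance] instUniformSpace_literature rk1 nF nE

variable {E : IntermediateField F (AlgebraicClosure F)} [FiniteDimensional F E] (hE : E ≤ maxUnramified F)

/-- **`𝒪_E → 𝒪_{F^nr}`, `x ↦ x`** for a finite `E ⊆ F^{nr}`: elements of `𝒪_E` are absolute integers lying in
`F^{nr}`. [cite: deShalit1987, I.3.8 (p. 20)] -/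
def unitBallToMaxUnramifiedIntegers : unitBall E →+* maxUnramifiedIntegers F where
  toFun x := ⟨((x : E) : AlgebraicClosure F),
    mem_maxUnramifiedIntegers_iff.2 ⟨coe_mem_absIntegers E x, hE (x : E).2⟩⟩
  map_one' := Subtype.ext (by simp)
  map_mul' x y := Subtype.ext (by simp)
  map_zero' := Subtype.ext (by simp)
  map_add' x y := Subtype.ext (by simp)

/-- Unfolding: `(x : F̄)`. [cite: deShalit1987, I.3.8 (p. 20)] -/
@[simp] theorem coe_unitBallToMaxUnramifiedIntegers (x : unitBall E) :
    ((unitBallToMaxUnramifiedIntegers hE x : maxUnramifiedIntegers F) : AlgebraicClosure F) =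
      ((x : E) : AlgebraicClosure F) := rfl

/-- On `𝒪_F` it is the structure map `𝒪_F → 𝒪_{F^nr}`. [cite: deShalit1987, I.3.8 (p. 20)] -/
theorem unitBallToMaxUnramifiedIntegers_algebraMap (a : LTCoeff F) :
    unitBallToMaxUnramifiedIntegers hE (algebraMap (LTCoeff F) (unitBall E) a) =
      algebraMap 𝒪[F] (maxUnramifiedIntegers F) ((LTCoeff.of F).symm a) := by
  apply Subtype.ext
  rw [coe_unitBallToMaxUnramifiedIntegers, coe_algebraMap_maxUnramifiedIntegers]
  change ((algebraMap F E (((LTCoeff.of F).symm a : 𝒪[F]) : F) : E) : AlgebraicClosure F) = _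
  rw [IsScalarTower.algebraMap_apply 𝒪[F] F (AlgebraicClosure F)]
  rfl

/-- **The coefficient map `j : 𝒪_E → 𝐃 = 𝒪̂_{F^nr}`** (`𝒪_E ⊆ 𝒪_{F^nr} → 𝒪̂_{F^nr}`, on the discrete copy
`UnrCoeff F`). [cite: deShalit1987, I.3.8 (p. 20), I.3.3 (p. 17)] -/
def unitBallToUnrCoeff : unitBall E →+* UnrCoeff F :=
  (UnrCoeff.of F).toRingHom.comp
    ((algebraMap (maxUnramifiedIntegers F) (maxUnramifiedCompletion F)).comp (unitBallToMaxUnramifiedIntegers hE))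

/-- Unfolding of `j`. [cite: deShalit1987, I.3.8 (p. 20)] -/
theorem unitBallToUnrCoeff_apply (x : unitBall E) :
    unitBallToUnrCoeff hE x = UnrCoeff.of F
      (algebraMap (maxUnramifiedIntegers F) (maxUnramifiedCompletion F) (unitBallToMaxUnramifiedIntegers hE x)) := rfl

/-- **`j` is the identity on `𝒪_F`**, pointwise: `j(a) = intToUnrCoeff a`. [cite: deShalit1987, I.3.8 (p. 20)] -/
theorem unitBallToUnrCoeff_algebraMap (a : LTCoeff F) :
    unitBallToUnrCoeff hE (algebraMap (LTCoeff F) (unitBall E) a) = intToUnrCoeff F ((LTCoeff.of F).symm a) := by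
  rw [unitBallToUnrCoeff_apply, unitBallToMaxUnramifiedIntegers_algebraMap, ← maxUnramifiedCompletion.algebraMap_eq]
  rfl

/-- ★ **`hj`**: `j ∘ (LTCoeff F → 𝒪_E) = intToUnrCoeff ∘ (LTCoeff F ≃ 𝒪_F)` — the hypothesis `hj` of
`PAdicOneVariableSeriesFamilyOfRelNormCoherentUnits.lean`. [cite: deShalit1987, I.3.8 (p. 20)] -/
theorem unitBallToUnrCoeff_comp_algebraMap :
    (unitBallToUnrCoeff hE).comp (algebraMap (LTCoeff F) (unitBall E)) =
      (intToUnrCoeff F).comp (LTCoeff.of F).symm.toRingHom :=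
  RingHom.ext fun a => unitBallToUnrCoeff_algebraMap hE a

/-- **`ι(j x) = x` in `ℂ_F`**: the coefficient map followed by `ι : 𝐃 → 𝒪_{ℂ_F}` is `𝒪_E ⊆ F̄ ⊆ ℂ_F`, pointwise.
[cite: deShalit1987, I.3.8 (p. 20)] [cite: SerreLocalFields1979, Ch. II §5] -/
theorem algebraMap_unitBallToUnrCoeff (x : unitBall E) :
    algebraMap (UnrCoeff F) (CBall F) (unitBallToUnrCoeff hE x) = unitBallToCBall E x := by
  apply Subtype.ext
  rw [coe_unitBallToCBall]
  change maxUnramifiedCompletion.toC F ((UnrCoeff.of F).symm (unitBallToUnrCoeff hE x)) = _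
  rw [unitBallToUnrCoeff_apply, RingEquiv.symm_apply_apply, toC_algebraMap', coe_unitBallToMaxUnramifiedIntegers]

/-- ★ **`hjC`**: `(𝐃 → 𝒪_{ℂ_F}) ∘ j = unitBallToCBall E` — the hypothesis `hjC` of the socket theorem of
`PAdicOneVariableSeriesFamilyOfRelNormCoherentUnits.lean`. [cite: deShalit1987, I.3.8 (p. 20)] [cite: SerreLocalFields1979, Ch. II §5] -/
theorem algebraMap_comp_unitBallToUnrCoeff :
    (algebraMap (UnrCoeff F) (CBall F)).comp (unitBallToUnrCoeff hE) = unitBallToCBall E :=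
  RingHom.ext fun x => algebraMap_unitBallToUnrCoeff hE x

end UnramifiedBaseToCompletedIntegers

end Literature.NumberTheory.GaloisRepresentations

end
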